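import Mathlib
import Summits.Ventures.PercRepro2.AsymPins

/-!
# The red-only pin with cube-level sources: where exactly the i = 0 row is hard
(seat mine-b, cell pub-perc-repro2; conjectures/MINE-B.md §14 Addendum 5)

`absHA_redPin_zero_two_le` (AsymPins.lean) has sources `pack(O ∪ γ) ≥ 2` — blue may not use the red-only
pin `q`.  The (RS) form of the i = 0 row (RSForm.lean) has the cube-level sources
`(A(O ∪ ·)) □ (A(O ∪ q ∪ ·)) at γ` — blue may use `q` once and the two witnesses may share the pins — and
the cube-level targets `¬ (A_q □ A_q at ρ)`.  Here the sources are strengthened to the cube level while the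
targets keep the true packing: **`redPin_cube_sources`** —
`#{γ ⊆ Y : A □ A_q at γ ∧ ρ ∉ A_q} ≤ #{γ ⊆ Y : A (O ∪ γ) ∧ pack(O ∪ q ∪ ρ) = 1}`,
by the same three steps (the swapped defect `{pack(O ∪ q ∪ γ) ≥ 2 ∧ A (O ∪ ρ)}` lies in `A □ A_q ∧ A_q ρ`,
disjointly from the sources, and Reimer for `(A, A_q)` bounds `A □ A_q`).  Consequently the only gap
between the theorem and (RS) is on the target side: the configurations with `pack(O ∪ q ∪ ρ) = 1` whose
two red witnesses are disjoint only outside `O ∪ q` (`rs_gap`).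
-/

open Finset

namespace Summit.Ventures.PercRepro2

namespace StepZero

open ReimerCube

variable {E : Type*} [DecidableEq E]

open Classical

/-- **the red-only pin with cube-level sources**: `#{γ ⊆ Y : A □ A_q at γ ∧ ¬ A_q ρ} ≤ absHA A (insert q O) O Y 1 1`
(`A_q = A (insert q O ∪ ·)`, `ρ = Y \ γ`). -/
theorem redPin_cube_sources {A : Finset E → Prop} (hA : Incr A) (O Y : Finset E) (q : E) :
    (Y.powerset.filter (fun γ => DOcc (fun X => A (O ∪ X)) (fun X => A (insert q O ∪ X)) γ ∧
      ¬ A (insert q O ∪ (Y \ γ)))).card ≤ absHA A (insert q O) O Y 1 1 := by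
  set B₀ : Finset E → Prop := fun X => A (O ∪ X) with hB₀
  set B₁ : Finset E → Prop := fun X => A (insert q O ∪ X) with hB₁
  have iB₀ : Incr B₀ := fun _ _ h hS => hA (Finset.union_subset_union_right h) hS
  have iB₁ : Incr B₁ := fun _ _ h hS => hA (Finset.union_subset_union_right h) hS
  have hB01 : ∀ S, B₀ S → B₁ S := fun S h =>
    hA (Finset.union_subset_union_left (Finset.subset_insert q O)) h
  -- the swapped defect lies in `B₀ □ B₁ ∧ B₁ ρ`
  have hX : (Y.powerset.filter (fun γ => pinK A (insert q O) 2 γ ∧ B₀ (Y \ γ))).card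
      ≤ (Y.powerset.filter (fun γ => DOcc B₀ B₁ γ ∧ B₁ (Y \ γ))).card := by
    apply Finset.card_le_card
    intro γ hγ
    rw [Finset.mem_filter] at hγ ⊢
    exact ⟨hγ.1, dOcc_pinned_of_pinK_two_insert hA O q hγ.2.1, hB01 _ hγ.2.2⟩
  -- the two parts of `B₀ □ B₁`
  have hsum : (Y.powerset.filter (fun γ => DOcc B₀ B₁ γ ∧ B₁ (Y \ γ))).card
      + (Y.powerset.filter (fun γ => DOcc B₀ B₁ γ ∧ ¬ B₁ (Y \ γ))).card
      = (Y.powerset.filter (fun γ => DOcc B₀ B₁ γ)).card := by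
    rw [← Finset.card_filter_add_card_filter_not (fun γ => B₁ (Y \ γ))
      (s := Y.powerset.filter (fun γ => DOcc B₀ B₁ γ)), Finset.filter_filter, Finset.filter_filter]
  -- Reimer for the pair `(B₀, B₁)`
  have hR := reimer_increasing Y B₀ B₁ iB₀ iB₁
  -- the targets are `#{B₀ γ ∧ B₁ ρ}` minus the defect `#{B₀ γ ∧ pack(insert q O ∪ ρ) ≥ 2}`
  have hT : absHA A (insert q O) O Y 1 1
      + (Y.powerset.filter (fun γ => B₀ γ ∧ pinK A (insert q O) 2 (Y \ γ))).card
      = (Y.powerset.filter (fun γ => B₀ γ ∧ B₁ (Y \ γ))).card := by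
    rw [← Finset.card_filter_add_card_filter_not (fun γ => pinK A (insert q O) 2 (Y \ γ))
      (s := Y.powerset.filter (fun γ => B₀ γ ∧ B₁ (Y \ γ))), Finset.filter_filter,
      Finset.filter_filter, Nat.add_comm]
    congr 1
    · apply congrArg Finset.card
      apply Finset.filter_congr
      intro γ _
      constructor
      · rintro ⟨h1, h2⟩
        refine ⟨⟨h1, ?_⟩, h2⟩
        exact (pinK_one_iff hA _ _).mp (pinK_of_succ A (insert q O) 1 h2)
      · rintro ⟨⟨h1, -⟩, h2⟩; exact ⟨h1, h2⟩
    · unfold absHA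
      apply congrArg Finset.card
      apply Finset.filter_congr
      intro γ _
      rw [pinK_one_iff hA, pinK_one_iff hA]
      constructor
      · rintro ⟨h1, h2, h3⟩; exact ⟨⟨h3, h1⟩, h2⟩
      · rintro ⟨⟨h3, h1⟩, h2⟩; exact ⟨h1, h2, h3⟩
  -- the swap
  have hsw : (Y.powerset.filter (fun γ => B₀ γ ∧ pinK A (insert q O) 2 (Y \ γ))).card
      = (Y.powerset.filter (fun γ => pinK A (insert q O) 2 γ ∧ B₀ (Y \ γ))).card :=
    card_filter_swap B₀ (pinK A (insert q O) 2) Y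
  -- assemble: sources + (B₀ □ B₁ ∧ B₁ ρ) = #(B₀ □ B₁) ≤ #{B₀ γ ∧ B₁ ρ} = targets + defect ≤ targets + (B₀ □ B₁ ∧ B₁ ρ)
  have key : (Y.powerset.filter (fun γ => DOcc B₀ B₁ γ ∧ ¬ B₁ (Y \ γ))).card
      + (Y.powerset.filter (fun γ => DOcc B₀ B₁ γ ∧ B₁ (Y \ γ))).card
      ≤ absHA A (insert q O) O Y 1 1
      + (Y.powerset.filter (fun γ => DOcc B₀ B₁ γ ∧ B₁ (Y \ γ))).card := by
    calc (Y.powerset.filter (fun γ => DOcc B₀ B₁ γ ∧ ¬ B₁ (Y \ γ))).card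
        + (Y.powerset.filter (fun γ => DOcc B₀ B₁ γ ∧ B₁ (Y \ γ))).card
        = (Y.powerset.filter (fun γ => DOcc B₀ B₁ γ)).card := by rw [Nat.add_comm]; exact hsum
      _ ≤ (Y.powerset.filter (fun γ => B₀ γ ∧ B₁ (Y \ γ))).card := hR
      _ = absHA A (insert q O) O Y 1 1
          + (Y.powerset.filter (fun γ => B₀ γ ∧ pinK A (insert q O) 2 (Y \ γ))).card := hT.symm
      _ = absHA A (insert q O) O Y 1 1
          + (Y.powerset.filter (fun γ => pinK A (insert q O) 2 γ ∧ B₀ (Y \ γ))).card := by rw [hsw]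
      _ ≤ absHA A (insert q O) O Y 1 1
          + (Y.powerset.filter (fun γ => DOcc B₀ B₁ γ ∧ B₁ (Y \ γ))).card :=
          Nat.add_le_add_left hX _
  exact Nat.le_of_add_le_add_right key

/-- the targets of the theorem split into the (RS) targets and the **gap**: red configurations of true
packing `1` whose two witnesses are disjoint only outside the pins and `q` -/
theorem rs_gap {A : Finset E → Prop} (hA : Incr A) (O Y : Finset E) (q : E) :
    absHA A (insert q O) O Y 1 1
      = (Y.powerset.filter (fun γ => A (O ∪ γ) ∧ A (insert q O ∪ (Y \ γ)) ∧
          ¬ DOcc (fun X => A (insert q O ∪ X)) (fun X => A (insert q O ∪ X)) (Y \ γ))).card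
        + (Y.powerset.filter (fun γ => A (O ∪ γ) ∧ pinK A (insert q O) 1 (Y \ γ) ∧
          ¬ pinK A (insert q O) 2 (Y \ γ) ∧
          DOcc (fun X => A (insert q O ∪ X)) (fun X => A (insert q O ∪ X)) (Y \ γ))).card := by
  unfold absHA
  rw [← Finset.card_filter_add_card_filter_not
    (fun γ => DOcc (fun X => A (insert q O ∪ X)) (fun X => A (insert q O ∪ X)) (Y \ γ))
    (s := Y.powerset.filter (fun γ => pinK A (insert q O) 1 (Y \ γ) ∧
      ¬ pinK A (insert q O) (1 + 1) (Y \ γ) ∧ pinK A O 1 γ)), Finset.filter_filter, Finset.filter_filter,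
    Nat.add_comm]
  congr 1
  · apply congrArg Finset.card
    apply Finset.filter_congr
    intro γ _
    rw [pinK_one_iff hA, pinK_one_iff hA]
    constructor
    · rintro ⟨⟨h1, -, h3⟩, h4⟩; exact ⟨h3, h1, h4⟩
    · rintro ⟨h3, h1, h4⟩
      exact ⟨⟨h1, fun h2 => h4 (dOcc_pinned_of_pinK_two hA (insert q O) h2), h3⟩, h4⟩
  · apply congrArg Finset.card
    apply Finset.filter_congr
    intro γ _
    rw [pinK_one_iff hA, pinK_one_iff hA]
    constructor
    · rintro ⟨⟨h1, h2, h3⟩, h4⟩; exact ⟨h3, h1, h2, h4⟩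
    · rintro ⟨h3, h1, h2, h4⟩; exact ⟨⟨h1, h2, h3⟩, h4⟩

end StepZero

end Summit.Ventures.PercRepro2
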